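import Summits.NavierStokesRegularity.FluidComputer.ClayBlowupOfBreakdown
import Summits.NavierStokesRegularity.FluidComputer.ClayBlowupRows
import Literature.Analysis.FluidPDE.AxisymmetricNoSwirlAprioriForced
import Literature.Analysis.FluidPDE.ForcedSymmetryPreservation
import Literature.Analysis.FluidPDE.LerayEnstrophyAPrioriForced
import Literature.Analysis.FluidPDE.ClayForceTimeShift
import Literature.Analysis.FluidPDE.TaoForcedUniquenessSchwartzForce
import HarnessLib

/-!
# Forced Ladyzhenskaya / Ukhovskii–Yudovich: NO Clay blow-up — and no tower realisation — in the
# axisymmetric swirl-free class WITH an axisymmetric swirl-free Clay force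

Cell `ns-blowup`, seat `ns-blowup-lean` (g9). LABEL: E–C typing (KERNEL — no named fact; the analytic
input is the Literature theorem `axisymmetricNoSwirl_enstrophy_apriori_forced`, Lemarié-Rieusset 2016
Thm. 10.4 WITH a force). WHAT THIS IS NOT: not Navier–Stokes blow-up evidence — a classical 1968
global-regularity theorem (Ladyzhenskaya; Ukhovskii–Yudovich) carried to the FORCED Clay class the
register's designs live in; nothing is constructed.

Until this file the tree emptied the axisymmetric swirl-free class only for UNFORCED designs
(`axisymmetric_no_swirl_global_regularity_holds`; refuter g12's KJ-10
`Realisation.not_axisym_noSwirl_of_force_zero`, `EpisodeInductionG.isEmpty_stage_of_noSwirl`;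
planner g18's hygiene line STATUS l.4085 (2)). With a Clay force `f` that is itself axisymmetric
without swirl at all times `t ≥ 0`:

* `ClayBlowup.not_axisym_noSwirl` — a Clay blow-up (`ClayBlowup ν`, ecbridge-2 g5: finite-energy
  classical forced evolution of a Clay datum with finite lifespan) is NEVER axisymmetric swirl-free in
  datum AND force. Proof: symmetry is inherited on every closed sub-slab
  (`IsClassicalNSSolutionOn.isAxisymmetric_of_clayForce` / `hasNoSwirl_of_clayForce`, lean g8); the
  slab energy (`ClayBlowup.energy_le`), the datum's `H²` size and the force's `H¹`/`H²` slab bounds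
  (`HasUniformRapidDecayOn.hasBoundedSobolevNormsOn_Icc`) feed the forced a-priori bound, giving ONE
  enstrophy bound on `[0, T)` — which `ClayBlowup.not_exists_enstrophy_bound` (the `H¹` alternative,
  F2 discharged) forbids;
* `DesignedBlowup.not_axisym_noSwirl` — the same for the strong type;
* `exists_claySolution_of_axisym_noSwirl` — **global regularity, forced**: for `ν > 0`, a Clay datum
  and a Clay force both axisymmetric without swirl, the forced system has a global Clay-class solution
  `(1)–(3), (6), (7)` (the dichotomy `ClayEvolution.exists_claySolution_or_clayBlowup` has an empty
  second branch);
* `PalasekTowerClayBridge.Realisation.not_axisym_noSwirl` — the FORCED half of KJ-10's §1: no tower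
  realisation (any rates `R`) has axisymmetric swirl-free datum and force
  (`Realisation.not_exists_claySolution` with W14 = `tao_unconditional_uniqueness_velocity_forced_holds`).

References: O. A. Ladyzhenskaya, Zap. Naučn. Sem. LOMI 7 (1968) 155–177; M. R. Ukhovskii,
V. I. Yudovich, J. Appl. Math. Mech. 32 (1968) 52–69; P. G. Lemarié-Rieusset, *The Navier–Stokes
Problem in the 21st Century* (2016), Thm. 10.4 [cite: LemarieRieusset2016, Thm. 10.4 (p. 285)];
C. L. Fefferman, Clay problem description, (C) [cite: FeffermanClay2006, (C)]; J. Leray, Acta Math. 63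
(1934) §32 [cite: Leray1934, §32]; T. Tao, Anal. PDE 6 (2013), Cor. 11.4 [cite: Tao2011, Cor. 11.4].
-/

noncomputable section

namespace Summit.NavierStokesRegularity.FluidComputer

open Set MeasureTheory Filter Topology Function
open scoped ENNReal ContDiff NNReal
open Literature.Analysis.FluidPDE
open Summit.NavierStokesRegularity.NavierStokesRegularity
open Summit.NavierStokesRegularity.FluidComputer.PalasekTowerClayBridge

namespace ClayBlowup

variable {ν : ℝ} (X : ClayBlowup ν)

/-- **A Clay blow-up is never axisymmetric without swirl in datum AND force** (forced
Ladyzhenskaya 1968 / Ukhovskii–Yudovich 1968 through Lemarié-Rieusset 2016, Thm. 10.4; `ν > 0`; no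
named fact). If `u(0)` were axisymmetric swirl-free and `f(t)` axisymmetric swirl-free for all
`t ≥ 0`, then on every closed sub-slab `[0, T']`, `T' < T`, the solution stays in the class
(forced symmetry preservation), and the forced a-priori enstrophy bound
`axisymmetricNoSwirl_enstrophy_apriori_forced` — fed the slab energy, the datum's `H²` size and the
force's slab `H¹`/`H²` bounds, all uniform in `T' < T` — bounds `∫ |∇u(t)|²` on `[0, T)`,
contradicting the `H¹` alternative `not_exists_enstrophy_bound`. [cite: LemarieRieusset2016, Thm. 10.4 (p. 285)] -/
theorem not_axisym_noSwirl (hν : 0 < ν) :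
    ¬ (IsAxisymmetric (X.u 0) ∧ HasNoSwirl (X.u 0) ∧
        (∀ t : ℝ, 0 ≤ t → IsAxisymmetric (X.f t)) ∧ (∀ t : ℝ, 0 ≤ t → HasNoSwirl (X.f t))) := by
  rintro ⟨hA, hS, hfA, hfS⟩
  have hT := X.T_pos
  -- slab energy on `[0, T)`
  obtain ⟨E, hEt, hE⟩ := X.energy_le hν
  -- the datum is in `H^∞`
  have hG : ∫⁻ x, ‖iteratedFDeriv ℝ 1 (X.u 0) x‖ₑ ^ 2 < ⊤ :=
    X.datum_decay.lintegral_enorm_iteratedFDeriv_sq_lt_top 1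
  have hH : ∫⁻ x, ‖iteratedFDeriv ℝ 2 (X.u 0) x‖ₑ ^ 2 < ⊤ :=
    X.datum_decay.lintegral_enorm_iteratedFDeriv_sq_lt_top 2
  -- the force has bounded Sobolev norms on `[0, T]`
  have hfD : HasUniformRapidDecayOn (Icc 0 X.T) X.f :=
    X.force_decay.hasUniformRapidDecayOn_Icc X.force_smooth hT
  obtain ⟨hfB, -⟩ := hfD.hasBoundedSobolevNormsOn_Icc (X.force_smooth.isSmoothSpaceTimeOn_Icc X.T) hT
  obtain ⟨P₁, hP₁⟩ := hfB 1
  obtain ⟨P₂, hP₂⟩ := hfB 2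
  -- the a-priori constant
  obtain ⟨K, hK0, hK⟩ := axisymmetricNoSwirl_enstrophy_apriori_forced hν hT
    (ENNReal.toReal_nonneg (a := E))
    (ENNReal.toReal_nonneg (a := ∫⁻ x, ‖iteratedFDeriv ℝ 1 (X.u 0) x‖ₑ ^ 2))
    (ENNReal.toReal_nonneg (a := ∫⁻ x, ‖iteratedFDeriv ℝ 2 (X.u 0) x‖ₑ ^ 2))
    (P₁.coe_nonneg) (P₂.coe_nonneg)
  -- ONE enstrophy bound on `[0, T)`
  refine X.not_exists_enstrophy_bound hν ⟨(3 * K).toNNReal, fun t ht => ?_⟩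
  have hcoe : (((3 * K).toNNReal : ℝ≥0) : ℝ≥0∞) = ENNReal.ofReal (3 * K) := rfl
  rw [hcoe]
  -- the closed sub-slab `[0, T']`, `T' = (t + T)/2`
  set T' : ℝ := (t + X.T) / 2 with hT'def
  have hT'0 : 0 < T' := by rw [hT'def]; linarith [ht.1, hT]
  have hT'lt : T' < X.T := by rw [hT'def]; linarith [ht.2]
  have htT' : t ≤ T' := by rw [hT'def]; linarith [ht.2]
  have hsol := X.classical_Icc hT'0 hT'lt
  have hHs := X.hasBoundedSobolevNormsOn hν hT'0 hT'lt
  obtain ⟨h₀, h₁⟩ := X.memLp_datum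
  have huE : ∃ C : ℝ≥0∞, C < ⊤ ∧ ∀ s ∈ Icc 0 T', ∫⁻ x, ‖X.u s x‖ₑ ^ 2 ≤ C := X.energy T' hT'lt
  have hfA' : ∀ s ∈ Icc 0 T', IsAxisymmetric (X.f s) := fun s hs => hfA s hs.1
  have hfS' : ∀ s ∈ Icc 0 T', HasNoSwirl (X.f s) := fun s hs => hfS s hs.1
  have hax : ∀ s ∈ Icc 0 T', IsAxisymmetric (X.u s) :=
    hsol.isAxisymmetric_of_clayForce hν hT'0 h₀ h₁ X.force_smooth X.force_decay rfl huE hfA' hA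
  have hsw : ∀ s ∈ Icc 0 T', HasNoSwirl (X.u s) :=
    hsol.hasNoSwirl_of_clayForce hν hT'0 h₀ h₁ X.force_smooth X.force_decay rfl huE hfA' hfS' hA hS
  have hEs : ∀ s ∈ Icc 0 T', ∫⁻ x, ‖X.u s x‖ₑ ^ 2 ≤ ENNReal.ofReal E.toReal := fun s hs => by
    rw [ENNReal.ofReal_toReal hEt.ne]
    exact hE s ⟨hs.1, hs.2.trans_lt hT'lt⟩
  have hGs : ∫⁻ x, ‖iteratedFDeriv ℝ 1 (X.u 0) x‖ₑ ^ 2 ≤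
      ENNReal.ofReal (∫⁻ x, ‖iteratedFDeriv ℝ 1 (X.u 0) x‖ₑ ^ 2).toReal := by
    rw [ENNReal.ofReal_toReal hG.ne]
  have hHs' : ∫⁻ x, ‖iteratedFDeriv ℝ 2 (X.u 0) x‖ₑ ^ 2 ≤
      ENNReal.ofReal (∫⁻ x, ‖iteratedFDeriv ℝ 2 (X.u 0) x‖ₑ ^ 2).toReal := by
    rw [ENNReal.ofReal_toReal hH.ne]
  have hP₁s : ∀ s ∈ Icc 0 T', ∫⁻ x, ‖iteratedFDeriv ℝ 1 (X.f s) x‖ₑ ^ 2 ≤ ENNReal.ofReal (P₁ : ℝ) :=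
    fun s hs => by
    rw [ENNReal.ofReal_coe_nnreal]
    exact hP₁ s ⟨hs.1, hs.2.trans hT'lt.le⟩
  have hP₂s : ∀ s ∈ Icc 0 T', ∫⁻ x, ‖iteratedFDeriv ℝ 2 (X.f s) x‖ₑ ^ 2 ≤ ENNReal.ofReal (P₂ : ℝ) :=
    fun s hs => by
    rw [ENNReal.ofReal_coe_nnreal]
    exact hP₂ s ⟨hs.1, hs.2.trans hT'lt.le⟩
  have hDt := hK hT'0 hT'lt.le hsol hHs hax hsw hfA' hfS' hEs hGs hHs' hP₁s hP₂s t ⟨ht.1, htT'⟩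
  -- `∫ |∇u(t)|²_F ≤ 3 ∫ ‖Du(t)‖² ≤ 3K`
  have n1 : ∀ x, ‖fderiv ℝ (X.u t) x‖ = ‖iteratedFDeriv ℝ 1 (X.u t) x‖ := fun x => by
    rw [← norm_iteratedFDeriv_fderiv, norm_iteratedFDeriv_zero]
  calc ∫⁻ x, ENNReal.ofReal (frobeniusNormSq (fderiv ℝ (X.u t) x))
      ≤ ∫⁻ x, 3 * ‖fderiv ℝ (X.u t) x‖ₑ ^ 2 :=
        lintegral_mono fun x => ofReal_frobeniusNormSq_le_three_mul_enorm_sq _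
    _ = 3 * ∫⁻ x, ‖iteratedFDeriv ℝ 1 (X.u t) x‖ₑ ^ 2 := by
        rw [lintegral_const_mul' _ _ (by norm_num)]
        congr 1
        refine lintegral_congr fun x => ?_
        rw [← ofReal_norm, ← ofReal_norm, n1 x]
    _ ≤ 3 * ENNReal.ofReal K := mul_le_mul_right hDt 3
    _ = ENNReal.ofReal (3 * K) := by
        rw [ENNReal.ofReal_mul (by norm_num : (0:ℝ) ≤ 3), ENNReal.ofReal_ofNat]

/-- Packaged: for a Clay blow-up with axisymmetric swirl-free FORCE, the datum is not axisymmetric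
without swirl. [cite: LemarieRieusset2016, Thm. 10.4 (p. 285)] -/
theorem not_axisym_noSwirl_datum (hν : 0 < ν) (hfA : ∀ t : ℝ, 0 ≤ t → IsAxisymmetric (X.f t))
    (hfS : ∀ t : ℝ, 0 ≤ t → HasNoSwirl (X.f t)) :
    ¬ (IsAxisymmetric (X.u 0) ∧ HasNoSwirl (X.u 0)) :=
  fun h => X.not_axisym_noSwirl hν ⟨h.1, h.2, hfA, hfS⟩

end ClayBlowup

/-- **A designed blow-up is never axisymmetric without swirl in datum and force** (through
`DesignedBlowup.toClayBlowup`). [cite: LemarieRieusset2016, Thm. 10.4 (p. 285)] -/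
theorem DesignedBlowup.not_axisym_noSwirl {ν : ℝ} (D : DesignedBlowup ν) (hν : 0 < ν) :
    ¬ (IsAxisymmetric (D.u 0) ∧ HasNoSwirl (D.u 0) ∧
        (∀ t : ℝ, 0 ≤ t → IsAxisymmetric (D.f t)) ∧ (∀ t : ℝ, 0 ≤ t → HasNoSwirl (D.f t))) :=
  D.toClayBlowup.not_axisym_noSwirl hν

/-- **GLOBAL REGULARITY OF AXISYMMETRIC NAVIER–STOKES WITHOUT SWIRL, WITH AN AXISYMMETRIC SWIRL-FREE
CLAY FORCE** (Ladyzhenskaya 1968; Ukhovskii–Yudovich 1968; Lemarié-Rieusset 2016, Thm. 10.4 — the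
printed theorem has `f = 0`; Ladyzhenskaya's carries the force). For `ν > 0`, a smooth divergence-free
rapidly decaying datum `u₀` (Fefferman (4)) and a Clay force `f` (smooth on `[0, ∞) × ℝ³` with the
decay (5)), both axisymmetric without swirl (`f(t)` for every `t ≥ 0`), the forced Navier–Stokes
system has a GLOBAL Clay-class solution: `(u, p)` smooth on `[0, ∞) × ℝ³`, solving (1)–(3) with force
`f` from `u₀`, of bounded energy (7). Proof: ecbridge-2's dichotomy
`ClayEvolution.exists_claySolution_or_clayBlowup`; the blow-up branch is empty by
`ClayBlowup.not_axisym_noSwirl`. [cite: LemarieRieusset2016, Thm. 10.4 (p. 285)] -/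
theorem exists_claySolution_of_axisym_noSwirl {ν : ℝ} (hν : 0 < ν)
    {u₀ : EuclideanSpace ℝ (Fin 3) → EuclideanSpace ℝ (Fin 3)}
    {f : ℝ → EuclideanSpace ℝ (Fin 3) → EuclideanSpace ℝ (Fin 3)}
    (hu₀ : ContDiff ℝ ∞ u₀) (hdiv : NSWave0.IsDivFree u₀) (hdec : HasRapidSpatialDecay u₀)
    (hs : IsSmoothOnHalfSpace f) (hd : HasRapidSpaceTimeDecay f)
    (hA : IsAxisymmetric u₀) (hS : HasNoSwirl u₀)
    (hfA : ∀ t : ℝ, 0 ≤ t → IsAxisymmetric (f t)) (hfS : ∀ t : ℝ, 0 ≤ t → HasNoSwirl (f t)) :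
    ∃ (u : ℝ → EuclideanSpace ℝ (Fin 3) → EuclideanSpace ℝ (Fin 3))
      (p : ℝ → EuclideanSpace ℝ (Fin 3) → ℝ),
      IsSmoothOnHalfSpace u ∧ IsSmoothOnHalfSpace p ∧
        IsNavierStokesSolution ν f u₀ u p ∧ HasBoundedEnergy u := by
  rcases ClayEvolution.exists_claySolution_or_clayBlowup hν hu₀ hdiv hdec hs hd with h | ⟨B, hB0, hBf⟩
  · exact h
  · exfalso
    refine B.not_axisym_noSwirl hν ⟨?_, ?_, ?_, ?_⟩
    · rw [hB0]; exact hA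
    · rw [hB0]; exact hS
    · intro t ht; rw [hBf]; exact hfA t ht
    · intro t ht; rw [hBf]; exact hfS t ht

namespace PalasekTowerClayBridge.Realisation

variable {ν : ℝ} {R : TowerRates} (W : Realisation ν R)

/-- **No tower realisation is axisymmetric without swirl in datum AND force** — the FORCED half of
KJ-10 §1 (`not_axisym_noSwirl_of_force_zero` needed `W.f = 0`): the design `(W.u 0, W.f)` of a
realisation is a Clay datum with a Clay force, so if both were axisymmetric swirl-free the forced
global-regularity theorem `exists_claySolution_of_axisym_noSwirl` would produce the global Clay-class
solution that `Realisation.not_exists_claySolution` (W14 = the tree theorem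
`tao_unconditional_uniqueness_velocity_forced_holds`) forbids. [cite: LemarieRieusset2016, Thm. 10.4 (p. 285)] -/
theorem not_axisym_noSwirl (hν : 0 < ν) :
    ¬ (IsAxisymmetric (W.u 0) ∧ HasNoSwirl (W.u 0) ∧
        (∀ t : ℝ, 0 ≤ t → IsAxisymmetric (W.f t)) ∧ (∀ t : ℝ, 0 ≤ t → HasNoSwirl (W.f t))) := by
  rintro ⟨hA, hS, hfA, hfS⟩
  obtain ⟨v, q, hv, hq, hns, hE⟩ := exists_claySolution_of_axisym_noSwirl hν W.contDiff_datum
    W.divFree_datum W.datum_decay W.force_smooth W.force_decay hA hS hfA hfS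
  exact W.not_exists_claySolution tao_unconditional_uniqueness_velocity_forced_holds hν
    ⟨v, q, hv, hq, hns, hE⟩

/-- Packaged for the register: a realisation whose FORCE is axisymmetric swirl-free at all `t ≥ 0`
cannot have an axisymmetric swirl-free datum. [cite: LemarieRieusset2016, Thm. 10.4 (p. 285)] -/
theorem not_axisym_noSwirl_datum (hν : 0 < ν) (hfA : ∀ t : ℝ, 0 ≤ t → IsAxisymmetric (W.f t))
    (hfS : ∀ t : ℝ, 0 ≤ t → HasNoSwirl (W.f t)) :
    ¬ (IsAxisymmetric (W.u 0) ∧ HasNoSwirl (W.u 0)) :=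
  fun h => W.not_axisym_noSwirl hν ⟨h.1, h.2, hfA, hfS⟩

end PalasekTowerClayBridge.Realisation

end Summit.NavierStokesRegularity.FluidComputer

end
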